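import Literature.IUT.HodgeTheaters.PMBaseBridgePropsProofs6

/-!
# Proofs over [IUTchI] Prop 6.6 (iv): rigidity of gluing data over a fixed index bijection

Mochizuki, *Inter-universal Teichmüller theory I*, §6, Proposition 6.6 (iv) p. 166, kurims manuscript
(May 2020). PROOF-ONLY companion (theorems, no definitions) to abc-iut-L5-t4's `PMBaseBridgeProps.lean`,
by the L5 discharge seat abc-iut-L5-t13. The RIGIDITY half of the third clause of `GluingTorsor`: two
gluing data over the same index bijection that both glue differ by a CONSTANT sign twist `∈ {±1}^𝕍`
(`GluingData.exists_relTwist`), for base kits with a valuation. Mechanism: reading the gluing condition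
on `±`-label classes, each gluing datum determines at every `t` a bracket
`T_{z(t)} ∘ Γ ∘ T_{−w(t)}` of the torsor `LabCusp^±(𝒟^{⊚±})` which is either the identity or the fixed
involution `ρ = L n L⁻¹`; its type cannot change with `t` (else `ρ` would be a translation, forcing
`2 = 0` in `𝔽_l`), and the relative sign of the two data is the product of the two bracket types and a
`t`-independent sign read off `†φ^{Θ±}_±`.
Record only; [claim: Mochizuki2012, status: disputed]; nothing here takes a side on any disputed step.
-/

namespace Literature.IUT.HodgeTheaters

open CategoryTheory

universe u

namespace PMBaseKit

variable {l : ℕ} {K : PMBaseKit.{u} l}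

namespace DThetaEllBridge

/-- Translations of `LabCusp^±(𝒟^{⊚±})` compose additively. [claim: Mochizuki2012, status: disputed] -/
theorem gTransl_trans (a b : ZMod l) : (gTransl K a).trans (gTransl K b) = gTransl K (a + b) := by
  ext q
  simp [gTransl, add_assoc]

/-- The inverse of a translation. [claim: Mochizuki2012, status: disputed] -/
theorem gTransl_symm (a : ZMod l) : (gTransl K a).symm = gTransl K (-a) := by
  ext q
  rw [Equiv.symm_apply_eq]
  simp [gTransl]

/-- The zero translation. [claim: Mochizuki2012, status: disputed] -/
theorem gTransl_zero : gTransl K (0 : ZMod l) = Equiv.refl _ := by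
  ext q
  simp [gTransl]

/-- **`ρ = L ∘ (−1) ∘ L⁻¹` is not a translation**: conjugating `z ↦ −z` on `LabCusp^±(𝒟_v)` by the
bijection induced by `φ^{Θell}_{•,v}` never gives a translation of `LabCusp^±(𝒟^{⊚±})` (it would force
`2 = 0` in `𝔽_l`). [claim: Mochizuki2012, status: disputed] -/
theorem conj_labNeg_ne_gTransl (v : K.V) (c : ZMod l) :
    (Equiv.ofBijective _ (K.labOfHom_phiEll_bijective v)).symm.trans
        ((labNeg (K.isLocal_model v)).trans (Equiv.ofBijective _ (K.labOfHom_phiEll_bijective v))) ≠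
      gTransl K c := by
  intro heq
  obtain ⟨L, hL⟩ : ∃ L : K.LabCuspPM v (K.model v) ≃ K.GLab K.gModel,
      Equiv.ofBijective _ (K.labOfHom_phiEll_bijective v) = L := ⟨_, rfl⟩
  rw [hL] at heq
  let S : FlPMGroup l (K.LabCuspPM v (K.model v)) := K.labPM v (K.model v) ⟨Iso.refl _⟩
  obtain ⟨h, hh⟩ := K.gLabT.exists_of_mem K.gChart₀_mem (K.labOfHom_phiEll_charts v _ S.chart₀_mem)
  rw [hL] at hh
  have hhq : ∀ q, S.chart₀ (L.symm q) = h • K.gChart₀ q := fun q => by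
    have := congrArg (fun E => E q) hh
    simpa using this
  have hnm : ∀ m, S.chart₀ (labNeg (K.isLocal_model v) m) = -S.chart₀ m := fun m => by
    simp [labNeg, S, Units.smul_def]
  have hρ : ∀ q, h • K.gChart₀ (L (labNeg (K.isLocal_model v) (L.symm q))) = -(h • K.gChart₀ q) := fun q => by
    rw [← hhq, ← hhq, Equiv.symm_apply_apply, hnm]
  have hc : ∀ q, K.gChart₀ (L (labNeg (K.isLocal_model v) (L.symm q))) = K.gChart₀ q + c := fun q => by
    have := congrArg (fun E => K.gChart₀ (E q)) heq
    simpa [gTransl] using this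
  have h0 := hρ (K.gChart₀.symm 0)
  have h1 := hρ (K.gChart₀.symm 1)
  rw [hc] at h0 h1
  simp only [FlPM.smul_def, Units.smul_def, zsmul_eq_mul, Equiv.apply_symm_apply, mul_zero, zero_add] at h0 h1
  have hε : ((h.right : ℤ) : ZMod l) * ((h.right : ℤ) : ZMod l) = 1 := by
    rcases Int.units_eq_one_or h.right with hr | hr <;> simp [hr]
  have h2ε : (2 : ZMod l) * ((h.right : ℤ) : ZMod l) = 0 := by linear_combination h1 - h0
  exact two_ne_zero_of_isLocal (K.isLocal_model v) (by linear_combination ((h.right : ℤ) : ZMod l) * h2ε - 2 * hε)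

end DThetaEllBridge

/-! ### Brackets -/

/-- From the key equation to the bracket: `LabCusp^±(a ∘ φ ∘ a'⁻¹) = L ∘ (E ∘ E'⁻¹) ∘ L⁻¹`.
[claim: Mochizuki2012, status: disputed] -/
theorem labMap_eq_bracket {v : K.V} {X Y : K.Amb v} {G : K.Glob} (a : K.model v ≅ X) (a' : K.model v ≅ Y)
    (φ : X ≅ Y) {E E' : K.GLab K.gModel ≃ K.GLab G}
    (hkey : (K.labMap v φ).trans ((K.labMap v a'.symm).trans
        ((Equiv.ofBijective _ (K.labOfHom_phiEll_bijective v)).trans E')) =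
      (K.labMap v a.symm).trans ((Equiv.ofBijective _ (K.labOfHom_phiEll_bijective v)).trans E)) :
    K.labMap v (a ≪≫ φ ≪≫ a'.symm) =
      (Equiv.ofBijective _ (K.labOfHom_phiEll_bijective v)).trans
        ((E.trans E'.symm).trans (Equiv.ofBijective _ (K.labOfHom_phiEll_bijective v)).symm) := by
  ext m
  have h := congrArg (fun F => (Equiv.ofBijective _ (K.labOfHom_phiEll_bijective v)).symm
    (E'.symm (F (K.labMap v a m)))) hkey
  simp only [Equiv.trans_apply, Equiv.symm_apply_apply, labMap_symm] at h
  rw [K.labMap_trans, K.labMap_trans, labMap_symm]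
  simpa using h

/-- A bracket is the identity or the involution `ρ = L⁻¹ n L`… precisely: if `L ∘ br ∘ L⁻¹` is induced by
an automorphism of `𝒟_v`, then `br = 1` or `br = L n L⁻¹`. [claim: Mochizuki2012, status: disputed] -/
theorem bracket_two_valued {v : K.V} (ψ : K.model v ≅ K.model v) {br : K.GLab K.gModel ≃ K.GLab K.gModel}
    (h : K.labMap v ψ = (Equiv.ofBijective _ (K.labOfHom_phiEll_bijective v)).trans
        (br.trans (Equiv.ofBijective _ (K.labOfHom_phiEll_bijective v)).symm)) :
    br = Equiv.refl _ ∨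
      br = (Equiv.ofBijective _ (K.labOfHom_phiEll_bijective v)).symm.trans
        ((labNeg (K.isLocal_model v)).trans (Equiv.ofBijective _ (K.labOfHom_phiEll_bijective v))) := by
  have hbr : br = (Equiv.ofBijective _ (K.labOfHom_phiEll_bijective v)).symm.trans
      ((K.labMap v ψ).trans (Equiv.ofBijective _ (K.labOfHom_phiEll_bijective v))) := by
    rw [h]; ext q; simp
  rcases labMap_eq_refl_or_labNeg (K.isLocal_model v) ψ with h1 | h1
  · left; rw [hbr, h1]; ext q; simp
  · right; rw [hbr, h1]

/-- **Parity constancy of brackets**: a bracket `T_z ∘ Γ ∘ T_{−w}` cannot be the identity at one index and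
the involution `ρ` at another (else `ρ` would be a translation). [claim: Mochizuki2012, status: disputed] -/
theorem bracket_parity_const (v : K.V) (Γ : K.GLab K.gModel ≃ K.GLab K.gModel) (z w z' w' : ZMod l)
    (h1 : (DThetaEllBridge.gTransl K z).trans (Γ.trans (DThetaEllBridge.gTransl K (-w))) = Equiv.refl _)
    (h2 : (DThetaEllBridge.gTransl K z').trans (Γ.trans (DThetaEllBridge.gTransl K (-w'))) =
      (Equiv.ofBijective _ (K.labOfHom_phiEll_bijective v)).symm.trans
        ((labNeg (K.isLocal_model v)).trans (Equiv.ofBijective _ (K.labOfHom_phiEll_bijective v)))) :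
    False := by
  have hΓ : Γ = DThetaEllBridge.gTransl K (-z + w) := by
    rw [← DThetaEllBridge.gTransl_trans]
    ext q
    have := congrArg (fun F => (DThetaEllBridge.gTransl K (-w)).symm (F ((DThetaEllBridge.gTransl K z).symm q))) h1
    simp only [Equiv.trans_apply, Equiv.apply_symm_apply, Equiv.symm_apply_apply, Equiv.refl_apply] at this
    rw [DThetaEllBridge.gTransl_symm, DThetaEllBridge.gTransl_symm, neg_neg] at this
    simpa using this
  rw [hΓ, DThetaEllBridge.gTransl_trans, DThetaEllBridge.gTransl_trans] at h2
  exact DThetaEllBridge.conj_labNeg_ne_gTransl v _ h2.symm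

/-- Normal form of a bracket: `(T_z ∘ A) ∘ (T_w ∘ B)⁻¹ = T_z ∘ (A ∘ B⁻¹) ∘ T_{−w}`.
[claim: Mochizuki2012, status: disputed] -/
theorem bracket_normal_form {G : K.Glob} (A B : K.GLab K.gModel ≃ K.GLab G) (z w : ZMod l) :
    ((DThetaEllBridge.gTransl K z).trans A).trans ((DThetaEllBridge.gTransl K w).trans B).symm =
      (DThetaEllBridge.gTransl K z).trans ((A.trans B.symm).trans (DThetaEllBridge.gTransl K (-w))) := by
  ext q
  simp [DThetaEllBridge.gTransl_symm]

/-! ### Reading a gluing datum on `±`-label classes -/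

namespace GluingData

/-- **The key equation for gluing data**: if `G` glues with coordinates `(ι₀, α₀, β₀, γ₀)`, then for every
`t, v`, `LabCusp^±(φ_{t,v}) ≫ ‡ζ^{Θell}_{v_{κ t}} = zetaCandidate (α₀)_t γ₀ (ι₀⁻¹ t)`, where `φ_t` spans
`G.poly t` ([IUTchI] Prop 6.6 (iv) p. 166). [claim: Mochizuki2012, status: disputed] -/
theorem labMap_trans_zeta {B : K.DThetaPMBridge} {B' : K.DThetaEllBridge} (G : GluingData B B') (t : B.T)
    (v : K.V) {φ : (B.capsule t).Iso (B'.capsule (G.indexEquiv t))} (hφ : G.poly t = DStrip.plusFullPolyIso φ)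
    {a : (DStrip.model K).Iso (B.capsule t)} {γ₀ : K.gModel ≅ B'.glob} {z : ZMod l}
    (hE : G.polyEll t v = K.ellConj a γ₀ v (Ex63.poly K z v))
    {ζ' : K.LabCuspPM v ((B'.capsule (G.indexEquiv t)).obj v) ≃ K.GLab B'.glob}
    (hζ' : B'.ZetaSpec (G.indexEquiv t) v ζ') :
    (K.labMap v (φ v)).trans ζ' = DThetaEllBridge.zetaCandidate v (a v) γ₀ z := by
  obtain ⟨g, hg⟩ := B'.poly_nonempty (G.indexEquiv t) v
  have hmem : (φ v).hom ≫ g ∈ G.polyEll t v := ⟨φ, by rw [hφ]; exact DStrip.self_mem_plusFullPolyIso φ, g, hg, rfl⟩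
  rw [hE] at hmem
  have h1 := DThetaEllBridge.labOfHom_of_mem_ellConj a γ₀ z v hmem
  rw [K.labOfHom_pre, hζ'.1 g hg] at h1
  exact Equiv.ext fun x => congrFun h1 x

/-- **Rigidity of gluing data** ([IUTchI] Prop 6.6 (iv) p. 166, the `{±1}^𝕍`-torsor clause): two gluing
data over the same index bijection which both glue differ by a CONSTANT sign twist — there is
`σ ∈ {±1}^𝕍` with `P₁(t) = P₀(t) · Aut^σ(‡𝔇_{κ t})` for every `t` (base kits with a valuation).
[claim: Mochizuki2012, status: disputed] -/
theorem exists_relTwist {B : K.DThetaPMBridge} {B' : K.DThetaEllBridge}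
    (κ : B.T ≃ B'.T) (P₀ P₁ : ∀ t, Set ((B.capsule t).Iso (B'.capsule (κ t))))
    (hP₀ : ∀ t, DStrip.IsPlusFullPolyIso (P₀ t)) (hP₁ : ∀ t, DStrip.IsPlusFullPolyIso (P₁ t))
    (h₀ : (GluingData.mk κ P₀ hP₀).Glues) (h₁ : (GluingData.mk κ P₁ hP₁).Glues) :
    ∃ σ : K.V → ℤˣ, ∀ t, P₁ t = DStrip.polyComp (P₀ t) ((B'.capsule (κ t)).signedPolyAut σ) := by
  classical
  have hP₀' := hP₀
  have hP₁' := hP₁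
  choose φ₀ hφ₀ using hP₀'
  choose φ₁ hφ₁ using hP₁'
  -- coordinates of the two gluings and of `B'`
  obtain ⟨-, ι₀, hι₀, α₀, β₀, γ₀, hB₀, hE₀⟩ := h₀
  obtain ⟨-, ι₁, hι₁, α₁, β₁, γ₁, hB₁, hE₁⟩ := h₁
  obtain ⟨ι', hι', α', γ', hE'⟩ := B'.exists_model
  have hZ' := B'.inducesZeta
  -- transported coordinates at arbitrary indices
  let αT₀ : ∀ t : B.T, (DStrip.model K).Iso (B.capsule t) := fun t v =>
    α₀ (ι₀.symm t) v ≪≫ eqToIso (congrArg (fun s => (B.capsule s).obj v) (ι₀.apply_symm_apply t))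
  have hαT₀ : ∀ z, αT₀ (ι₀ z) = α₀ z := fun z =>
    DStrip.isoCast_eq (fun s => B.capsule (ι₀ s)) _ α₀ (ι₀.symm_apply_apply z)
  let αT₁ : ∀ t : B.T, (DStrip.model K).Iso (B.capsule t) := fun t v =>
    α₁ (ι₁.symm t) v ≪≫ eqToIso (congrArg (fun s => (B.capsule s).obj v) (ι₁.apply_symm_apply t))
  have hαT₁ : ∀ z, αT₁ (ι₁ z) = α₁ z := fun z =>
    DStrip.isoCast_eq (fun s => B.capsule (ι₁ s)) _ α₁ (ι₁.symm_apply_apply z)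
  let αT' : ∀ s : B'.T, (DStrip.model K).Iso (B'.capsule s) := fun s v =>
    α' (ι'.symm s) v ≪≫ eqToIso (congrArg (fun r => (B'.capsule r).obj v) (ι'.apply_symm_apply s))
  have hαT' : ∀ z, αT' (ι' z) = α' z := fun z =>
    DStrip.isoCast_eq (fun r => B'.capsule (ι' r)) _ α' (ι'.symm_apply_apply z)
  -- general-index forms of the model equations
  have hE₀' : ∀ t v, GluingData.polyEll ⟨κ, P₀, hP₀⟩ t v =
      K.ellConj (αT₀ t) γ₀ v (Ex63.poly K (ι₀.symm t) v) := by
    intro t v; obtain ⟨z, rfl⟩ := ι₀.surjective t; rw [hαT₀, Equiv.symm_apply_apply]; exact hE₀ z v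
  have hE₁' : ∀ t v, GluingData.polyEll ⟨κ, P₁, hP₁⟩ t v =
      K.ellConj (αT₁ t) γ₁ v (Ex63.poly K (ι₁.symm t) v) := by
    intro t v; obtain ⟨z, rfl⟩ := ι₁.surjective t; rw [hαT₁, Equiv.symm_apply_apply]; exact hE₁ z v
  have hB₀' : ∀ t, B.poly t = DStrip.plusFullPolyIso ((αT₀ t).symm.trans β₀) := by
    intro t; obtain ⟨z, rfl⟩ := ι₀.surjective t
    rw [hαT₀, hB₀ z, Ex62.poly_eq, DStrip.polyConj_plusFullPolyIso]
    congr 1; funext v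
    change ((α₀ z v).symm ≪≫ CategoryTheory.Iso.refl _) ≪≫ β₀ v = (α₀ z v).symm ≪≫ β₀ v; simp
  have hB₁' : ∀ t, B.poly t = DStrip.plusFullPolyIso ((αT₁ t).symm.trans β₁) := by
    intro t; obtain ⟨z, rfl⟩ := ι₁.surjective t
    rw [hαT₁, hB₁ z, Ex62.poly_eq, DStrip.polyConj_plusFullPolyIso]
    congr 1; funext v
    change ((α₁ z v).symm ≪≫ CategoryTheory.Iso.refl _) ≪≫ β₁ v = (α₁ z v).symm ≪≫ β₁ v; simp
  have hζ' : ∀ t v, B'.ZetaSpec (κ t) v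
      (DThetaEllBridge.zetaCandidate v (αT' (κ t) v) γ' (ι'.symm (κ t))) := by
    intro t v
    obtain ⟨ζ, hζ⟩ := hZ' (κ t) v
    have hgen : ∀ (s : B'.T) (ζ : K.LabCuspPM v ((B'.capsule s).obj v) ≃ K.GLab B'.glob),
        B'.ZetaSpec s v ζ → ζ = DThetaEllBridge.zetaCandidate v (αT' s v) γ' (ι'.symm s) := by
      intro s ζ hζ; obtain ⟨z, rfl⟩ := ι'.surjective s
      rw [hαT', Equiv.symm_apply_apply]
      exact B'.zeta_eq_zetaCandidate (ι := ι') (α := α') (β := γ') hE' z v hζ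
    rw [← hgen _ ζ hζ]; exact hζ
  -- the key equations for both data
  have key₀ : ∀ t v, (K.labMap v (φ₀ t v)).trans
      (DThetaEllBridge.zetaCandidate v (αT' (κ t) v) γ' (ι'.symm (κ t))) =
      DThetaEllBridge.zetaCandidate v (αT₀ t v) γ₀ (ι₀.symm t) :=
    fun t v => labMap_trans_zeta ⟨κ, P₀, hP₀⟩ t v (hφ₀ t) (hE₀' t v) (hζ' t v)
  have key₁ : ∀ t v, (K.labMap v (φ₁ t v)).trans
      (DThetaEllBridge.zetaCandidate v (αT' (κ t) v) γ' (ι'.symm (κ t))) =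
      DThetaEllBridge.zetaCandidate v (αT₁ t v) γ₁ (ι₁.symm t) :=
    fun t v => labMap_trans_zeta ⟨κ, P₁, hP₁⟩ t v (hφ₁ t) (hE₁' t v) (hζ' t v)
  -- the relative sign and the twist vector `σ`, read at `t₀`
  let t₀ : B.T := ι₀ 0
  let σ : K.V → ℤˣ := fun v =>
    if (K.labMap v (φ₀ t₀ v)).symm.trans (K.labMap v (φ₁ t₀ v)) = Equiv.refl _ then 1 else -1
  refine ⟨σ, fun t => ?_⟩
  obtain ⟨a, ha⟩ := DStrip.exists_mem_signedPolyAut (B'.capsule (κ t)) σ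
  rw [show P₁ t = DStrip.plusFullPolyIso (φ₁ t) from hφ₁ t,
    show P₀ t = DStrip.plusFullPolyIso (φ₀ t) from hφ₀ t,
    DStrip.polyComp_plusFullPolyIso_signedPolyAut _ ha, DStrip.plusFullPolyIso_eq_iff]
  intro v
  have hav : K.labMap v (a v) = Equiv.refl _ ↔ σ v = 1 := (DStrip.mem_signedPolyAut_iff _ _).mp ha v
  -- notation at `v`
  set L := Equiv.ofBijective _ (K.labOfHom_phiEll_bijective v) with hL
  let n := labNeg (K.isLocal_model v)
  let ρ := L.symm.trans (n.trans L)
  let br₀ : B.T → (K.GLab K.gModel ≃ K.GLab K.gModel) := fun s =>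
    ((DThetaEllBridge.gTransl K (ι₀.symm s)).trans (K.gLabMap γ₀)).trans
      ((DThetaEllBridge.gTransl K (ι'.symm (κ s))).trans (K.gLabMap γ')).symm
  let br₁ : B.T → (K.GLab K.gModel ≃ K.GLab K.gModel) := fun s =>
    ((DThetaEllBridge.gTransl K (ι₁.symm s)).trans (K.gLabMap γ₁)).trans
      ((DThetaEllBridge.gTransl K (ι'.symm (κ s))).trans (K.gLabMap γ')).symm
  -- the brackets of the two data
  have hF₀ : ∀ s, K.labMap v (αT₀ s v ≪≫ φ₀ s v ≪≫ (αT' (κ s) v).symm) = L.trans ((br₀ s).trans L.symm) :=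
    fun s => labMap_eq_bracket (αT₀ s v) (αT' (κ s) v) (φ₀ s v) (key₀ s v)
  have hF₁ : ∀ s, K.labMap v (αT₁ s v ≪≫ φ₁ s v ≪≫ (αT' (κ s) v).symm) = L.trans ((br₁ s).trans L.symm) :=
    fun s => labMap_eq_bracket (αT₁ s v) (αT' (κ s) v) (φ₁ s v) (key₁ s v)
  have h2₀ : ∀ s, br₀ s = Equiv.refl _ ∨ br₀ s = ρ := fun s => bracket_two_valued _ (hF₀ s)
  have h2₁ : ∀ s, br₁ s = Equiv.refl _ ∨ br₁ s = ρ := fun s => bracket_two_valued _ (hF₁ s)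
  -- parity constancy
  have hpc : ∀ (br : B.T → (K.GLab K.gModel ≃ K.GLab K.gModel)) (ιx : ZMod l ≃ B.T) (γx : K.gModel ≅ B'.glob),
      (∀ s, br s = ((DThetaEllBridge.gTransl K (ιx.symm s)).trans (K.gLabMap γx)).trans
        ((DThetaEllBridge.gTransl K (ι'.symm (κ s))).trans (K.gLabMap γ')).symm) →
      ∀ s s', ¬ (br s = Equiv.refl _ ∧ br s' = ρ) := by
    intro br ιx γx hbr s s' ⟨h1, h2⟩
    rw [hbr, bracket_normal_form] at h1 h2
    exact bracket_parity_const v _ _ _ _ _ h1 h2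
  have hsame₀ : (br₀ t = Equiv.refl _ ∧ br₀ t₀ = Equiv.refl _) ∨ (br₀ t = ρ ∧ br₀ t₀ = ρ) := by
    rcases h2₀ t with h | h <;> rcases h2₀ t₀ with h' | h'
    · exact Or.inl ⟨h, h'⟩
    · exact (hpc br₀ ι₀ γ₀ (fun _ => rfl) t t₀ ⟨h, h'⟩).elim
    · exact (hpc br₀ ι₀ γ₀ (fun _ => rfl) t₀ t ⟨h', h⟩).elim
    · exact Or.inr ⟨h, h'⟩
  have hsame₁ : (br₁ t = Equiv.refl _ ∧ br₁ t₀ = Equiv.refl _) ∨ (br₁ t = ρ ∧ br₁ t₀ = ρ) := by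
    rcases h2₁ t with h | h <;> rcases h2₁ t₀ with h' | h'
    · exact Or.inl ⟨h, h'⟩
    · exact (hpc br₁ ι₁ γ₁ (fun _ => rfl) t t₀ ⟨h, h'⟩).elim
    · exact (hpc br₁ ι₁ γ₁ (fun _ => rfl) t₀ t ⟨h', h⟩).elim
    · exact Or.inr ⟨h, h'⟩
  -- the `t`-independent sign relating the two coordinate systems of the `Θ^±`-side
  have hμ : ∀ s, (K.labMap v (αT₁ s v)).trans (K.labMap v (αT₀ s v)).symm =
      (K.labMap v (β₁ v)).trans (K.labMap v (β₀ v)).symm := by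
    intro s
    have h := (hB₀' s).symm.trans (hB₁' s)
    rw [DStrip.plusFullPolyIso_eq_iff] at h
    have hv := h v
    change K.labMap v ((αT₀ s v).symm ≪≫ β₀ v) = K.labMap v ((αT₁ s v).symm ≪≫ β₁ v) at hv
    rw [K.labMap_trans, K.labMap_trans, labMap_symm, labMap_symm] at hv
    ext x
    have hx := congrArg (fun F => (K.labMap v (β₀ v)).symm (F (K.labMap v (αT₁ s v) x))) hv
    simpa using hx
  -- the relative sign at `s` is trivial iff `Ŷ₁ = M ∘ Ŷ₀`
  have hF₀e : ∀ s, (K.labMap v (αT₀ s v)).trans ((K.labMap v (φ₀ s v)).trans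
      (K.labMap v (αT' (κ s) v).symm)) = L.trans ((br₀ s).trans L.symm) := fun s => by
    rw [← K.labMap_trans, ← K.labMap_trans]; exact hF₀ s
  have hF₁e : ∀ s, (K.labMap v (αT₁ s v)).trans ((K.labMap v (φ₁ s v)).trans
      (K.labMap v (αT' (κ s) v).symm)) = L.trans ((br₁ s).trans L.symm) := fun s => by
    rw [← K.labMap_trans, ← K.labMap_trans]; exact hF₁ s
  have hEQ : ∀ s, ((K.labMap v (φ₀ s v)).symm.trans (K.labMap v (φ₁ s v)) = Equiv.refl _) ↔
      L.trans ((br₁ s).trans L.symm) =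
        ((K.labMap v (β₁ v)).trans (K.labMap v (β₀ v)).symm).trans (L.trans ((br₀ s).trans L.symm)) := by
    intro s
    rw [← labMap_symm, ← K.labMap_trans, labMap_symm_trans_eq_refl_iff, ← hF₀e s, ← hF₁e s, ← hμ s]
    constructor
    · intro h
      rw [h]
      ext x
      simp
    · intro h
      ext x
      have hx := congrArg
        (fun F => (K.labMap v (αT' (κ s) v).symm).symm (F ((K.labMap v (αT₁ s v)).symm x))) h
      simp only [Equiv.trans_apply, Equiv.apply_symm_apply, Equiv.symm_apply_apply] at hx
      exact hx.symm
  -- hence the relative sign is `t`-independent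
  have hconst : ((K.labMap v (φ₀ t v)).symm.trans (K.labMap v (φ₁ t v)) = Equiv.refl _) ↔
      ((K.labMap v (φ₀ t₀ v)).symm.trans (K.labMap v (φ₁ t₀ v)) = Equiv.refl _) := by
    rw [hEQ t, hEQ t₀]
    rcases hsame₀ with ⟨e1, e2⟩ | ⟨e1, e2⟩ <;> rcases hsame₁ with ⟨f1, f2⟩ | ⟨f1, f2⟩ <;>
      rw [e1, e2, f1, f2]
  -- conclude at `t` from the definition of `σ` at `t₀`
  have hσv : σ v = 1 ↔ (K.labMap v (φ₀ t₀ v)).symm.trans (K.labMap v (φ₁ t₀ v)) = Equiv.refl _ := by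
    constructor
    · intro h
      by_contra hne
      have : σ v = -1 := if_neg hne
      rw [this] at h
      exact absurd h (by decide)
    · intro h
      exact if_pos h
  have hS2 : (K.labMap v (φ₀ t v)).symm.trans (K.labMap v (φ₁ t v)) = Equiv.refl _ ∨
      (K.labMap v (φ₀ t v)).symm.trans (K.labMap v (φ₁ t v)) = labNeg ((B'.capsule (κ t)).isLocal v) := by
    rw [← labMap_symm, ← K.labMap_trans]
    exact labMap_eq_refl_or_labNeg _ _
  have hgoal : K.labMap v (φ₁ t v) = K.labMap v (φ₀ t v ≪≫ a v) ↔
      (K.labMap v (φ₀ t v)).symm.trans (K.labMap v (φ₁ t v)) = K.labMap v (a v) := by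
    rw [K.labMap_trans]
    constructor
    · intro h; rw [h]; ext x; simp
    · intro h; rw [← h]; ext x; simp
  change K.labMap v (φ₁ t v) = K.labMap v (φ₀ t v ≪≫ a v)
  rw [hgoal]
  rcases hS2 with h | h <;> rcases labMap_eq_refl_or_labNeg ((B'.capsule (κ t)).isLocal v) (a v) with h' | h'
  · rw [h, h']
  · exfalso
    have h1 : σ v = 1 := hσv.mpr (hconst.mp h)
    have h2 := hav.mpr h1
    rw [h'] at h2
    exact labNeg_ne_refl _ h2
  · exfalso
    have h1 : σ v = 1 := hav.mp h'
    have h2 := hconst.mpr (hσv.mp h1)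
    rw [h] at h2
    exact labNeg_ne_refl _ h2
  · rw [h, h']

end GluingData

end PMBaseKit

end Literature.IUT.HodgeTheaters
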